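/-
Copyright: the b2b-balaban T⁴-continuum CRUX team, row NE7b leaf lineage `t4-ne7b-formalise-leaf-05` (gen 160). Project licence.
-/
import Summits.QuantumFields.BalabanUV.T4Continuum.Support.ScalarBlockTrialFunction
import Literature.MathematicalPhysics.QuantumFieldTheory.Balaban1983to89.B5Composition116

/-!
# THE BOX-SMOOTHED BLOCK-CONSTANT INTERPOLANT ON PRINT's TORUS: for a coarse real or complex field `g` on `Tor M` and print's blocks of
# side `n` (`B5Block118.bpt`, `B5Blocks16.blockOf`), the field `A₁ := boxAvg ψ_g` — NE2's box translation average
# (`…Support.ScalarBlockPoincare.boxAvg`) of the block-constant extension `ψ_g = g ∘ blockOf` — has (i) `η`-ENERGY at most the coarse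
# Dirichlet energy, `Σ_μ nsq (∂_μ^{(n)}A₁) ≤ n^d·Σ_μ Σ_y ‖g(y + e_μ) − g(y)‖²` (constant exactly `1` in the `η^d`-weighted currency), and
# (ii) block means within `√d` coarse-Dirichlet norms of `g`, `nsq (Q′_n A₁ − g) ≤ d·Σ_μ Σ_y ‖g(y + e_μ) − g(y)‖²` — the two letters of the
# real-space competitor of `Literature.….B5Ineq167UpperZd` §2–§3 (`dir_energy_A1_le`, `tsum_defect_sq_le`), here on the TORUS, uniformly in
# `n` and in the volume (row NE7b, node U5c; [folklore] lattice bookkeeping over the tree's kernel lemmas BY NAME)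

Cell `pub-balaban`, sub-cell `t4`, spine estimate NE7b (`T4WeightBudget.RelWeightBound`; the cell's OWN estimate — NOT PRINTED in
[Bałaban 1983–89], NOT PROVED).  Crux-route work under `Spine/NE7b/` by a row leaf (`t4-ne7b-formalise-leaf-05` gen 160) under FREEZE (0)'s
crux-prover clause; the fifth file of this lineage's hard-flow packet (BADD ∕ BAKF ∕ BACS ∕ BAEC), the supplier of its sixth
(`…BlockAverageUpperBound`: print's (1.67) right half for the scalar torus flow).  NOTHING of Bałaban's is asserted; the inputs are the
tree's KERNEL lemmas BY NAME — NE2's `…Support.ScalarBlockPoincare` (`transS`, `nsq_transS`, `nsq_sum_le`, `boxAvg`, `legOf`,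
`iota_eq_sum_legOf`, `nsq_transS_partialSum_sub_le`, `nsq_QsOp_mulVec_le`), `…Support.ScalarBlockTrialFunction` (`bpt_update'`, the one-step
moves `bpt_add_unitVec_of_lt ∕ _of_eq`), `…Support.ScalarAveragedPropagator.dirichlet`, Literature `B5Block118` ∕ `B5Blocks16` (`bpt`, `tstep`,
`iota`, `blockOf`, `bpt_add_tstep`, `QsOp_blockConst`, `bpt_val`), `B5AverageCurlStokes.sum_blocks_real`, `B5Composition116.tstep_add`.  No
`T4Continuum/Support` leaf typed (three are READ); no `def`; zero `sorry`.

WHY.  The hard-flow packet has the free scalar flow's floor (BAKF, `2∕L²`), critical section (BACS) and a ceiling in HSMO's `‖·‖²`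
currency (BAEC, `4d·36^d·‖g‖²`); print's (1.67) RIGHT half is a ceiling in the COARSE DIRICHLET currency, `⟨g, Δ_k g⟩ ≤ γ₁⟨∂₁g, ∂₁g⟩` —
constants must go to constants.  On `ℤ^d` the tree proves it (`B5Ineq167UpperZd`, `γ₁(d) = 2 + 8d²·36^d`) by testing the minimality of
`H_kB` against an explicit competitor: the box-smoothed block-constant interpolant `A₁` corrected by a block bump so that the block
means are exact.  The bump correction is BAEC's bump section; THIS file supplies `A₁`'s two letters on the torus.  (i) ENERGY: the
`η`-gradient `∂_μ^{(n)}ψ_g` lives on the block FACES (`n·(g(y+e_μ) − g(y))` at the `n^{d−1}` sites of digit `j_μ = n − 1`, zero inside —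
`sdiff_blockConst_bpt`), so `nsq (∂_μψ_g) = n^{d+1}·Σ_y|Δ_μ g|²`; the box average commutes with `∂_μ` and THINS a face-supported field by
`n`: at a site `x` the `n^d` translates `F(x + ιj)` are non-zero only on ONE `μ`-slice of offsets (`v((x + ιj)_μ) ≡ v(x_μ) + j_μ (mod n)` —
the `μ`-digit sees only `j_μ`), so Cauchy–Schwarz costs the slice's `n^{d−1}`, not `n^d` (`nsq_boxAvg_faceSupported_le`); together
`η^d·Σ_μ nsq (∂_μ A₁) ≤ Σ|∂₁g|²`.  (ii) DEFECT: `boxAvg ψ − ψ = n^{−d}Σ_j (T_{ιj}ψ − ψ)`; a block-constant field moved straight by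
`t ≤ n` changes at each site by `0` or ONE coarse bond difference (`blockOf (n·y + j + t·e_ν) ∈ {y, y + e_ν}`), so
`nsq (T_{te_ν}ψ − ψ) ≤ n^d·Σ_y|Δ_ν g|²` with NO fine factor, and along the legs of `ιj`, `nsq (T_{ιj}ψ − ψ) ≤ d·n^d·Σ|∂₁g|²`; Jensen over
`j` and the contraction `nsq (Q′h) ≤ n^{−d} nsq h` give `nsq (Q′A₁ − g) ≤ d·Σ|∂₁g|²`.

WHAT IS PROVED ([folklore]; `n ≥ 1` via `[NeZero n]`, `M : Fin d → ℕ` with `M μ ≥ 1`, any `d`; `ψ_g := fun x => g (blockOf n M x)` for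
`g : Tor M → ℂ`; `E(g) := Σ_ν Σ_y ‖g(y + e_ν) − g(y)‖²` written out):
* §1 STRAIGHT MOVES: `bpt_eq_update_zero_add`, **`bpt_add_tstep_of_lt`** (`j_ν + t < n`: inside the block), **`bpt_add_tstep_of_ge`**
  (`n ≤ j_ν + t`, `t ≤ n`: across one face, into block `y + e_ν`), `blockOf_bpt_add_tstep` (`∈ {y, y + e_ν}`).
* §2 BLOCK-CONSTANT TRANSLATES: `transS_tstep_blockConst_sub_apply` (`∈ {0, g(y+e_ν) − g(y)}`), **`nsq_transS_tstep_blockConst_sub_le`**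
  (`≤ n^d·Σ_y‖g(y+e_ν) − g y‖²`, `t ≤ n`), **`nsq_transS_iota_blockConst_sub_le`** (`≤ d·n^d·E(g)`, every in-block offset `j`).
* §3 THE DEFECT: `boxAvg_sub_eq`, `nsq_boxAvg_blockConst_sub_le` (`≤ d·n^d·E(g)`), `QsOp_boxAvg_blockConst_sub`,
  **`nsq_QsOp_boxAvg_blockConst_sub_le`** (`nsq (Q′_n(boxAvg ψ_g) − g) ≤ d·E(g)`).
* §4 THE ENERGY: `sdiff_blockConst_bpt`, `sum_digitBox_coord` (`Σ_j φ(j_μ) = n^{d−1}·Σ_a φ a`), `nsq_sdiff_blockConst_le`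
  (`≤ n²·n^{d−1}·Σ_y‖Δ_μ g‖²`), `sdiff_boxAvg` (commutation), `val_add_iota_mod`, `apply_add_iota_ne_zero_digit_eq` (offsets with
  `F(x + ιj) ≠ 0` share `j_μ` when `F` is face-supported), `sdiff_blockConst_faceSupported`, **`nsq_boxAvg_faceSupported_le`**
  (`nsq (boxAvg F) ≤ n⁻¹·nsq F`), **`dirichlet_boxAvg_blockConst_le`** (`dirichlet n M (boxAvg ψ_g) ≤ n^d·E(g)`).

NOT HERE (honest): the competitor's assembly and print's (1.67) (`…BlockAverageUpperBound`); the `ℤ^d` statements (in the tree); the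
exact counts (`nsq (T_{te_ν}ψ − ψ) = t·n^{d−1}·Σ|Δg|²` — the crude `n^d` suffices); covariant `U ≠ 1`; anything of Bałaban's small-field
action ((A3) ∕ (A1c), NC-NE7b-α UNRULED).  BY-NAME EFFECT ON THE WALL: NONE.  NE7b NOT PRINTED ∕ NOT PROVED; spine PROVED 0∕9; rung (B)+1
on a FINITE torus — NOT infinite volume, NOT the mass gap, NOT Clay.  HONEST DEPENDENCY: continuum YM on T⁴ ⇐ BetaPertH ∧ nine spine
estimates (0∕9 proved); BetaPertH ⇐ (D1) ∧ (D4) ∧ CAP+tail; G-an2-4 gates asym, D1 and NE2∕3∕4.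
-/

set_option autoImplicit false

noncomputable section

namespace Summit.QuantumFields.BalabanUV.T4Continuum.NE7b.BlockAverageInterpolant

open Matrix Finset
open Literature.MathematicalPhysics.QuantumFieldTheory.Balaban1983to89
open B5Prop11Plancherel (Tor fine unitVec)
open B5Prop11Lower (nsq nsq_nonneg)
open B5Action121 (sdiff sdiff_mulVec)
open B5Block118 (QsOp QsOp_mulVec bpt tstep tstep_succ tstep_zero iota bpt_add_tstep)
open B5Blocks16 (blockOf blockOf_bpt bpt_bijective QsOp_blockConst)
open B5AverageCurlStokes (sum_blocks_real)
open B5Composition116 (tstep_add)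
open Summit.QuantumFields.BalabanUV.T4Continuum.ScalarBlockPoincare
  (transS transS_add transS_sub nsq_transS nsq_sum_le nsq_smul nsq_QsOp_mulVec_le boxAvg legOf iota_eq_sum_legOf
   nsq_transS_partialSum_sub_le sdiff_mulVec_eq)
open Summit.QuantumFields.BalabanUV.T4Continuum.ScalarBlockTrialFunction (bpt_update' bpt_add_unitVec_of_lt bpt_add_unitVec_of_eq)

variable {d : ℕ} (n : ℕ) [NeZero n] (M : Fin d → ℕ) [hM : ∀ μ, NeZero (M μ)]

/-! ## §1. Straight moves of a block point: `n·y + j + t·e_ν` for `0 ≤ t ≤ n` -/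

omit hM in
/-- `n·y + j = n·y + j[ν ↦ 0] + j_ν·e_ν`. [folklore] -/
theorem bpt_eq_update_zero_add (y : Tor M) (j : Fin d → Fin n) (ν : Fin d) :
    bpt n M y j = bpt n M y (Function.update j ν 0) + tstep (fine n M) ν (j ν : ℕ) := by
  conv_lhs => rw [← Function.update_eq_self ν j]
  exact bpt_update' n M y j ν (j ν)

omit hM in
/-- A straight move INSIDE the block: `n·y + j + t·e_ν = n·y + j[ν ↦ j_ν + t]` when `j_ν + t < n`. [folklore] -/
theorem bpt_add_tstep_of_lt (y : Tor M) (j : Fin d → Fin n) (ν : Fin d) {t : ℕ} (h : (j ν : ℕ) + t < n) :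
    bpt n M y j + tstep (fine n M) ν t = bpt n M y (Function.update j ν ⟨(j ν : ℕ) + t, h⟩) := by
  rw [bpt_update' n M y j ν ⟨_, h⟩, bpt_eq_update_zero_add n M y j ν, add_assoc, ← tstep_add]

omit hM in
/-- A straight move ACROSS one face: `n·y + j + t·e_ν = n·(y + e_ν) + j[ν ↦ j_ν + t − n]` when `n ≤ j_ν + t` and `t ≤ n`. [folklore] -/
theorem bpt_add_tstep_of_ge (y : Tor M) (j : Fin d → Fin n) (ν : Fin d) {t : ℕ} (ht : t ≤ n) (h : n ≤ (j ν : ℕ) + t) :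
    bpt n M y j + tstep (fine n M) ν t
      = bpt n M (y + unitVec M ν) (Function.update j ν ⟨(j ν : ℕ) + t - n, by have := (j ν).is_lt; omega⟩) := by
  rw [bpt_update' n M (y + unitVec M ν) j ν ⟨_, _⟩, bpt_eq_update_zero_add n M y j ν, add_assoc, ← tstep_add]
  have e : tstep (fine n M) ν ((j ν : ℕ) + t) = tstep (fine n M) ν n + tstep (fine n M) ν ((j ν : ℕ) + t - n) := by
    rw [← tstep_add]; congr 1; omega
  rw [e, ← add_assoc, bpt_add_tstep]

/-- The block of a straight move: `blockOf (n·y + j + t·e_ν) ∈ {y, y + e_ν}` for `t ≤ n`. [folklore] -/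
theorem blockOf_bpt_add_tstep (y : Tor M) (j : Fin d → Fin n) (ν : Fin d) {t : ℕ} (ht : t ≤ n) :
    blockOf n M (bpt n M y j + tstep (fine n M) ν t) = y ∨
      blockOf n M (bpt n M y j + tstep (fine n M) ν t) = y + unitVec M ν := by
  by_cases h : (j ν : ℕ) + t < n
  · left; rw [bpt_add_tstep_of_lt n M y j ν h, blockOf_bpt]
  · right; rw [bpt_add_tstep_of_ge n M y j ν ht (not_lt.mp h), blockOf_bpt]

/-! ## §2. Translates of a block-constant field: the straight-move and offset defects -/

/-- A block-constant field moved straight by `t ≤ n` changes, at each site, by `0` or by ONE coarse bond difference. [folklore] -/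
theorem transS_tstep_blockConst_sub_apply (g : Tor M → ℂ) (y : Tor M) (j : Fin d → Fin n) (ν : Fin d) {t : ℕ} (ht : t ≤ n) :
    (transS (fine n M) (tstep (fine n M) ν t) (fun x => g (blockOf n M x)) - fun x => g (blockOf n M x)) (bpt n M y j) = 0 ∨
    (transS (fine n M) (tstep (fine n M) ν t) (fun x => g (blockOf n M x)) - fun x => g (blockOf n M x)) (bpt n M y j)
      = g (y + unitVec M ν) - g y := by
  simp only [Pi.sub_apply, transS, blockOf_bpt]
  rcases blockOf_bpt_add_tstep n M y j ν ht with h | h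
  · left; rw [h, sub_self]
  · right; rw [h]

/-- Hence `nsq (T_{t·e_ν}ψ_g − ψ_g) ≤ n^d·Σ_y ‖g(y + e_ν) − g(y)‖²` for the block-constant `ψ_g = g ∘ blockOf` and `t ≤ n` (every site of
a block charged with its block's one bond — crude in `t`, free of fine factors). [folklore] -/
theorem nsq_transS_tstep_blockConst_sub_le (g : Tor M → ℂ) (ν : Fin d) {t : ℕ} (ht : t ≤ n) :
    nsq (transS (fine n M) (tstep (fine n M) ν t) (fun x => g (blockOf n M x)) - fun x => g (blockOf n M x))
      ≤ (n : ℝ) ^ d * ∑ y : Tor M, ‖g (y + unitVec M ν) - g y‖ ^ 2 := by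
  have hcard : (Fintype.card (Fin d → Fin n) : ℝ) = (n : ℝ) ^ d := by
    rw [Fintype.card_fun, Fintype.card_fin, Fintype.card_fin]; push_cast; ring
  unfold nsq
  rw [sum_blocks_real n M, Finset.mul_sum]
  refine Finset.sum_le_sum fun y _ => ?_
  calc ∑ j : Fin d → Fin n, ‖(transS (fine n M) (tstep (fine n M) ν t) (fun x => g (blockOf n M x)) -
          fun x => g (blockOf n M x)) (bpt n M y j)‖ ^ 2
      ≤ ∑ _j : Fin d → Fin n, ‖g (y + unitVec M ν) - g y‖ ^ 2 := by
        refine Finset.sum_le_sum fun j _ => ?_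
        rcases transS_tstep_blockConst_sub_apply n M g y j ν ht with h | h
        · rw [h, norm_zero, zero_pow two_ne_zero]; positivity
        · rw [h]
    _ = (n : ℝ) ^ d * ‖g (y + unitVec M ν) - g y‖ ^ 2 := by rw [Finset.sum_const, Finset.card_univ, nsmul_eq_mul, hcard]

/-- The OFFSET defect of a block-constant field: `nsq (T_{ιj}ψ_g − ψ_g) ≤ d·n^d·Σ_ν Σ_y ‖g(y + e_ν) − g(y)‖²` for every in-block offset
`j ∈ {0,…,n−1}^d` (telescoping over the legs of `ιj`, `…ScalarBlockPoincare.nsq_transS_partialSum_sub_le`). [folklore] -/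
theorem nsq_transS_iota_blockConst_sub_le (g : Tor M → ℂ) (j : Fin d → Fin n) :
    nsq (transS (fine n M) (iota n M j) (fun x => g (blockOf n M x)) - fun x => g (blockOf n M x))
      ≤ d * ((n : ℝ) ^ d * ∑ ν : Fin d, ∑ y : Tor M, ‖g (y + unitVec M ν) - g y‖ ^ 2) := by
  rw [iota_eq_sum_legOf n M j]
  refine (nsq_transS_partialSum_sub_le (fine n M) (legOf n M j) d _).trans ?_
  refine mul_le_mul_of_nonneg_left ?_ (Nat.cast_nonneg d)
  rw [Finset.mul_sum, ← Fin.sum_univ_eq_sum_range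
    (fun i => nsq (transS (fine n M) (legOf n M j i) (fun x => g (blockOf n M x)) - fun x => g (blockOf n M x))) d]
  refine Finset.sum_le_sum fun ν _ => ?_
  have e : legOf n M j (ν : ℕ) = tstep (fine n M) ν (j ν : ℕ) := by simp only [legOf, ν.is_lt, dif_pos]
  rw [e]
  exact nsq_transS_tstep_blockConst_sub_le n M g ν (j ν).is_lt.le

/-! ## §3. The defect of the block means of the box-smoothed interpolant -/

omit hM in
/-- `boxAvg f − f = n^{−d}·Σ_j (T_{ιj}f − f)`. [folklore] -/
theorem boxAvg_sub_eq (f : Tor (fine n M) → ℂ) :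
    boxAvg n M f - f = ((n : ℂ) ^ d)⁻¹ • ∑ j : Fin d → Fin n, (transS (fine n M) (iota n M j) f - f) := by
  have hnc : ((n : ℂ) ^ d) ≠ 0 := pow_ne_zero _ (by exact_mod_cast NeZero.ne n)
  rw [boxAvg, Finset.sum_sub_distrib, Finset.sum_const, Finset.card_univ, smul_sub]
  have hc : (Fintype.card (Fin d → Fin n)) • f = ((n : ℂ) ^ d) • f := by
    rw [Fintype.card_fun, Fintype.card_fin, Fintype.card_fin, ← Nat.cast_smul_eq_nsmul ℂ]; push_cast; rfl
  rw [hc, smul_smul, inv_mul_cancel₀ hnc, one_smul]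

/-- `nsq (boxAvg ψ_g − ψ_g) ≤ d·n^d·Σ_ν Σ_y ‖g(y + e_ν) − g(y)‖²` for the block-constant `ψ_g`. [folklore] -/
theorem nsq_boxAvg_blockConst_sub_le (g : Tor M → ℂ) :
    nsq (boxAvg n M (fun x => g (blockOf n M x)) - fun x => g (blockOf n M x))
      ≤ d * ((n : ℝ) ^ d * ∑ ν : Fin d, ∑ y : Tor M, ‖g (y + unitVec M ν) - g y‖ ^ 2) := by
  have hn : (0 : ℝ) < (n : ℝ) ^ d := pow_pos (by exact_mod_cast Nat.pos_of_ne_zero (NeZero.ne n)) d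
  have hcard : (Fintype.card (Fin d → Fin n) : ℝ) = (n : ℝ) ^ d := by
    rw [Fintype.card_fun, Fintype.card_fin, Fintype.card_fin]; push_cast; ring
  set E : ℝ := d * ((n : ℝ) ^ d * ∑ ν : Fin d, ∑ y : Tor M, ‖g (y + unitVec M ν) - g y‖ ^ 2) with hE
  rw [boxAvg_sub_eq, nsq_smul, norm_inv, norm_pow, Complex.norm_natCast]
  have h1 := nsq_sum_le (Finset.univ : Finset (Fin d → Fin n))
    (fun j => transS (fine n M) (iota n M j) (fun x => g (blockOf n M x)) - fun x => g (blockOf n M x))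
  rw [Finset.card_univ, hcard] at h1
  have h2 : ∑ j : Fin d → Fin n, nsq (transS (fine n M) (iota n M j) (fun x => g (blockOf n M x)) - fun x => g (blockOf n M x))
      ≤ ∑ _j : Fin d → Fin n, E := Finset.sum_le_sum fun j _ => nsq_transS_iota_blockConst_sub_le n M g j
  rw [Finset.sum_const, Finset.card_univ, nsmul_eq_mul, hcard] at h2
  have hE0 : 0 ≤ E := by positivity
  calc (((n : ℝ) ^ d)⁻¹) ^ 2 * nsq (∑ j : Fin d → Fin n,
        (transS (fine n M) (iota n M j) (fun x => g (blockOf n M x)) - fun x => g (blockOf n M x)))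
      ≤ (((n : ℝ) ^ d)⁻¹) ^ 2 * ((n : ℝ) ^ d * ((n : ℝ) ^ d * E)) :=
        mul_le_mul_of_nonneg_left (h1.trans (mul_le_mul_of_nonneg_left h2 hn.le)) (by positivity)
    _ = E := by field_simp

/-- `Q′(boxAvg ψ_g) − g = Q′(boxAvg ψ_g − ψ_g)` (`Q′ψ_g = g`, `B5Blocks16.QsOp_blockConst`). [folklore] -/
theorem QsOp_boxAvg_blockConst_sub (g : Tor M → ℂ) :
    QsOp n M *ᵥ boxAvg n M (fun x => g (blockOf n M x)) - g
      = QsOp n M *ᵥ (boxAvg n M (fun x => g (blockOf n M x)) - fun x => g (blockOf n M x)) := by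
  rw [Matrix.mulVec_sub, QsOp_blockConst]

/-- **THE DEFECT OF THE BLOCK MEANS**: `nsq (Q′(boxAvg ψ_g) − g) ≤ d·Σ_ν Σ_y ‖g(y + e_ν) − g(y)‖²` — the block means of the box-smoothed
block-constant interpolant miss `g` by at most `√d` times the coarse Dirichlet norm, uniformly in `n` and in the torus
(the torus twin of `B5Ineq167UpperZd.tsum_defect_sq_le`). [folklore] -/
theorem nsq_QsOp_boxAvg_blockConst_sub_le (g : Tor M → ℂ) :
    nsq (QsOp n M *ᵥ boxAvg n M (fun x => g (blockOf n M x)) - g)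
      ≤ d * ∑ ν : Fin d, ∑ y : Tor M, ‖g (y + unitVec M ν) - g y‖ ^ 2 := by
  have hn : (0 : ℝ) < (n : ℝ) ^ d := pow_pos (by exact_mod_cast Nat.pos_of_ne_zero (NeZero.ne n)) d
  rw [QsOp_boxAvg_blockConst_sub]
  refine (nsq_QsOp_mulVec_le n M _).trans ?_
  refine (mul_le_mul_of_nonneg_left (nsq_boxAvg_blockConst_sub_le n M g) (inv_nonneg.mpr hn.le)).trans ?_
  rw [← mul_assoc, ← mul_assoc, mul_comm (((n : ℝ) ^ d)⁻¹) (d : ℝ), mul_assoc (d : ℝ), inv_mul_cancel₀ hn.ne', mul_one]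

/-! ## §4. The energy of the box-smoothed interpolant: face-supported fields are thinned by the box average -/

/-- The `η`-gradient of a block-constant field lives on the faces: `(∂_μ^{(n)}ψ_g)(n·y + j) = n·(g(y + e_μ) − g(y))` if `j_μ = n − 1`, else `0`. [folklore] -/
theorem sdiff_blockConst_bpt (g : Tor M → ℂ) (μ : Fin d) (y : Tor M) (j : Fin d → Fin n) :
    (sdiff (fine n M) (n : ℂ) μ *ᵥ fun x => g (blockOf n M x)) (bpt n M y j)
      = if (j μ : ℕ) + 1 = n then (n : ℂ) * (g (y + unitVec M μ) - g y) else 0 := by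
  rw [sdiff_mulVec]
  by_cases h : (j μ : ℕ) + 1 = n
  · rw [if_pos h, bpt_add_unitVec_of_eq n M y j μ h, blockOf_bpt, blockOf_bpt]
  · have h' : (j μ : ℕ) + 1 < n := by have := (j μ).is_lt; omega
    rw [if_neg h, bpt_add_unitVec_of_lt n M y j μ h', blockOf_bpt, blockOf_bpt, sub_self, mul_zero]

omit [NeZero n] hM in
/-- Summing a function of ONE digit over the digit box: `Σ_{j ∈ {0..n−1}^d} φ(j_μ) = n^{d−1}·Σ_a φ(a)`. [folklore] -/
theorem sum_digitBox_coord (μ : Fin d) (φ : Fin n → ℝ) :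
    ∑ j : Fin d → Fin n, φ (j μ) = (n : ℝ) ^ (d - 1) * ∑ a : Fin n, φ a := by
  classical
  have h1 : ∀ j : Fin d → Fin n, φ (j μ) = ∏ ν : Fin d, (if ν = μ then φ (j ν) else (1 : ℝ)) := fun j => by
    rw [Finset.prod_ite_eq' Finset.univ μ (fun ν => φ (j ν)), if_pos (Finset.mem_univ μ)]
  simp_rw [h1]
  rw [← Fintype.prod_sum (fun (ν : Fin d) (a : Fin n) => if ν = μ then φ a else (1 : ℝ))]
  rw [← Finset.mul_prod_erase Finset.univ _ (Finset.mem_univ μ)]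
  have h0 : (∑ a : Fin n, if μ = μ then φ a else (1 : ℝ)) = ∑ a : Fin n, φ a := Finset.sum_congr rfl fun a _ => if_pos rfl
  have h2 : ∏ ν ∈ Finset.univ.erase μ, (∑ a : Fin n, if ν = μ then φ a else (1 : ℝ)) = (n : ℝ) ^ (d - 1) := by
    rw [Finset.prod_congr rfl fun ν hν => by rw [Finset.sum_congr rfl fun a _ => if_neg (Finset.ne_of_mem_erase hν)],
      Finset.prod_const, Finset.card_erase_of_mem (Finset.mem_univ μ), Finset.card_univ, Fintype.card_fin,
      Finset.sum_const, Finset.card_univ, Fintype.card_fin, nsmul_eq_mul, mul_one]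
  rw [h0, h2, mul_comm]

/-- `nsq (∂_μ^{(n)}ψ_g) = n²·n^{d−1}·Σ_y ‖g(y + e_μ) − g(y)‖²` bounded above (the face has `n^{d−1}` sites per block). [folklore] -/
theorem nsq_sdiff_blockConst_le (g : Tor M → ℂ) (μ : Fin d) :
    nsq (sdiff (fine n M) (n : ℂ) μ *ᵥ fun x => g (blockOf n M x))
      ≤ (n : ℝ) ^ 2 * ((n : ℝ) ^ (d - 1) * ∑ y : Tor M, ‖g (y + unitVec M μ) - g y‖ ^ 2) := by
  have hn1 : 1 ≤ n := Nat.pos_of_ne_zero (NeZero.ne n)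
  unfold nsq
  rw [sum_blocks_real n M, Finset.mul_sum, Finset.mul_sum]
  refine le_of_eq (Finset.sum_congr rfl fun y _ => ?_)
  have e : ∀ j : Fin d → Fin n, ‖(sdiff (fine n M) (n : ℂ) μ *ᵥ fun x => g (blockOf n M x)) (bpt n M y j)‖ ^ 2
      = if j μ = ⟨n - 1, by omega⟩ then (n : ℝ) ^ 2 * ‖g (y + unitVec M μ) - g y‖ ^ 2 else 0 := by
    intro j
    rw [sdiff_blockConst_bpt]
    have hiff : (j μ : ℕ) + 1 = n ↔ j μ = ⟨n - 1, by omega⟩ := by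
      rw [Fin.ext_iff]; constructor <;> intro h <;> simp only at h ⊢ <;> omega
    by_cases h : (j μ : ℕ) + 1 = n
    · rw [if_pos h, if_pos (hiff.mp h), norm_mul, mul_pow, Complex.norm_natCast]
    · rw [if_neg h, if_neg (fun h' => h (hiff.mpr h')), norm_zero, zero_pow two_ne_zero]
  have hs := sum_digitBox_coord n μ (fun a : Fin n => if a = ⟨n - 1, by omega⟩ then (n : ℝ) ^ 2 * ‖g (y + unitVec M μ) - g y‖ ^ 2 else 0)
  rw [Finset.sum_congr rfl fun j _ => e j, hs, Finset.sum_ite_eq', if_pos (Finset.mem_univ _)]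
  ring

/-- The box average commutes with `∂_μ`. [folklore] -/
theorem sdiff_boxAvg (c : ℂ) (μ : Fin d) (f : Tor (fine n M) → ℂ) :
    sdiff (fine n M) c μ *ᵥ boxAvg n M f = boxAvg n M (sdiff (fine n M) c μ *ᵥ f) := by
  funext x
  simp only [sdiff_mulVec, boxAvg, Pi.smul_apply, Finset.sum_apply, transS, smul_eq_mul]
  rw [Finset.mul_sum, Finset.mul_sum, Finset.mul_sum, ← Finset.sum_sub_distrib, Finset.mul_sum]
  refine Finset.sum_congr rfl fun j _ => ?_
  rw [add_right_comm x (unitVec (fine n M) μ) (iota n M j)]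
  ring

/-- The `μ`-digit of a translate by an in-block offset: `v((x + ιj)_μ) ≡ v(x_μ) + j_μ (mod n)`. [folklore] -/
theorem val_add_iota_mod (x : Tor (fine n M)) (j : Fin d → Fin n) (μ : Fin d) :
    ((x + iota n M j) μ).val % n = ((x μ).val + (j μ : ℕ)) % n := by
  have hN : n ∣ fine n M μ := Dvd.intro _ rfl
  have hj : ((iota n M j) μ).val = (j μ : ℕ) := by
    show (((j μ : ℕ) : ZMod (fine n M μ))).val = _
    rw [ZMod.val_natCast]
    exact Nat.mod_eq_of_lt (lt_of_lt_of_le (j μ).is_lt (Nat.le_of_dvd (Nat.pos_of_ne_zero (NeZero.ne _)) hN))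
  rw [Pi.add_apply, ZMod.val_add, Nat.mod_mod_of_dvd _ hN, hj]

/-- A FACE-SUPPORTED field — one vanishing off the sites whose `μ`-digit is `n − 1` — has, among its `n^d` in-block translates
at any site, at most one non-zero value per transversal offset: all offsets `j` with `F(x + ιj) ≠ 0` share the same `j_μ`. [folklore] -/
theorem apply_add_iota_ne_zero_digit_eq {F : Tor (fine n M) → ℂ} {μ : Fin d}
    (hF : ∀ x, F x ≠ 0 → (x μ).val % n = n - 1) (x : Tor (fine n M)) {j j' : Fin d → Fin n}
    (hj : F (x + iota n M j) ≠ 0) (hj' : F (x + iota n M j') ≠ 0) : j μ = j' μ := by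
  have h1 := hF _ hj
  have h2 := hF _ hj'
  rw [val_add_iota_mod] at h1 h2
  have hmod : Nat.ModEq n ((x μ).val + (j μ : ℕ)) ((x μ).val + (j' μ : ℕ)) := by
    unfold Nat.ModEq; rw [h1, h2]
  exact Fin.ext (Nat.ModEq.eq_of_lt_of_lt (Nat.ModEq.add_left_cancel' _ hmod) (j μ).is_lt (j' μ).is_lt)

/-- `η`-GRADIENT SUPPORT: `∂_μ^{(n)}ψ_g` is face-supported. [folklore] -/
theorem sdiff_blockConst_faceSupported (g : Tor M → ℂ) (μ : Fin d) (x : Tor (fine n M))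
    (hx : (sdiff (fine n M) (n : ℂ) μ *ᵥ fun x => g (blockOf n M x)) x ≠ 0) : (x μ).val % n = n - 1 := by
  obtain ⟨⟨y, j⟩, rfl⟩ := (bpt_bijective n M).2 x
  simp only at hx ⊢
  rw [sdiff_blockConst_bpt] at hx
  by_cases h : (j μ : ℕ) + 1 = n
  · rw [B5Blocks16.bpt_val, Nat.mul_add_mod, Nat.mod_eq_of_lt (j μ).is_lt]; omega
  · exact absurd (if_neg h) (fun e => hx (by rw [e]))

/-- **THE BOX AVERAGE THINS A FACE-SUPPORTED FIELD BY `n`**: `nsq (boxAvg F) ≤ n⁻¹·nsq F` — at each site only the `n^{d−1}` offsets of ONE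
`μ`-slice contribute, so Cauchy–Schwarz costs `n^{d−1}`, not `n^d`. [folklore] -/
theorem nsq_boxAvg_faceSupported_le {F : Tor (fine n M) → ℂ} {μ : Fin d} (hF : ∀ x, F x ≠ 0 → (x μ).val % n = n - 1) :
    nsq (boxAvg n M F) ≤ ((n : ℝ))⁻¹ * nsq F := by
  classical
  have hn0 : (0 : ℝ) < n := by exact_mod_cast Nat.pos_of_ne_zero (NeZero.ne n)
  have hn1 : 1 ≤ n := Nat.pos_of_ne_zero (NeZero.ne n)
  have hcard : (Fintype.card (Fin d → Fin n) : ℝ) = (n : ℝ) ^ d := by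
    rw [Fintype.card_fun, Fintype.card_fin, Fintype.card_fin]; push_cast; ring
  -- (2) the per-site slice bound
  have hslice : ∀ x : Tor (fine n M),
      ‖∑ j : Fin d → Fin n, F (x + iota n M j)‖ ^ 2 ≤ (n : ℝ) ^ (d - 1) * ∑ j : Fin d → Fin n, ‖F (x + iota n M j)‖ ^ 2 := by
    intro x
    set S := Finset.univ.filter (fun j : Fin d → Fin n => F (x + iota n M j) ≠ 0) with hS
    have hsum : ∑ j : Fin d → Fin n, F (x + iota n M j) = ∑ j ∈ S, F (x + iota n M j) := by
      rw [hS, Finset.sum_filter_ne_zero]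
    have hcardS : (S.card : ℝ) ≤ (n : ℝ) ^ (d - 1) := by
      by_cases hSe : S = ∅
      · rw [hSe, Finset.card_empty, Nat.cast_zero]; positivity
      · obtain ⟨j₀, hj₀⟩ := Finset.nonempty_iff_ne_empty.mpr hSe
        have hj₀' : F (x + iota n M j₀) ≠ 0 := (Finset.mem_filter.mp hj₀).2
        have hsub : S ⊆ Finset.univ.filter (fun j : Fin d → Fin n => j μ = j₀ μ) := fun j hj =>
          Finset.mem_filter.mpr ⟨Finset.mem_univ _, apply_add_iota_ne_zero_digit_eq n M hF x (Finset.mem_filter.mp hj).2 hj₀'⟩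
        have hsl : ((Finset.univ.filter (fun j : Fin d → Fin n => j μ = j₀ μ)).card : ℝ) = (n : ℝ) ^ (d - 1) := by
          have hs := sum_digitBox_coord n μ (fun a => if a = j₀ μ then (1 : ℝ) else 0)
          rw [Finset.sum_ite_eq' Finset.univ (j₀ μ), if_pos (Finset.mem_univ _), mul_one] at hs
          rw [Finset.card_filter]
          push_cast
          exact hs
        rw [← hsl]
        exact_mod_cast Finset.card_le_card hsub
    rw [hsum]
    calc ‖∑ j ∈ S, F (x + iota n M j)‖ ^ 2 ≤ (∑ j ∈ S, ‖F (x + iota n M j)‖) ^ 2 :=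
          pow_le_pow_left₀ (norm_nonneg _) (norm_sum_le _ _) 2
      _ ≤ S.card * ∑ j ∈ S, ‖F (x + iota n M j)‖ ^ 2 := sq_sum_le_card_mul_sum_sq
      _ ≤ (n : ℝ) ^ (d - 1) * ∑ j : Fin d → Fin n, ‖F (x + iota n M j)‖ ^ 2 :=
          mul_le_mul hcardS (Finset.sum_le_univ_sum_of_nonneg fun _ => by positivity) (Finset.sum_nonneg fun _ _ => by positivity)
            (by positivity)
  -- (3) the double sum is `n^d·nsq F`
  have hdouble : ∑ x : Tor (fine n M), ∑ j : Fin d → Fin n, ‖F (x + iota n M j)‖ ^ 2 = (n : ℝ) ^ d * nsq F := by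
    rw [Finset.sum_comm]
    have e : ∀ j : Fin d → Fin n, ∑ x : Tor (fine n M), ‖F (x + iota n M j)‖ ^ 2 = nsq F := fun j =>
      nsq_transS (fine n M) (iota n M j) F
    rw [Finset.sum_congr rfl fun j _ => e j, Finset.sum_const, Finset.card_univ, nsmul_eq_mul, hcard]
  -- (1) assemble
  have e1 : nsq (boxAvg n M F) = (((n : ℝ) ^ d)⁻¹) ^ 2 * ∑ x : Tor (fine n M), ‖∑ j : Fin d → Fin n, F (x + iota n M j)‖ ^ 2 := by
    unfold nsq boxAvg
    rw [Finset.mul_sum]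
    refine Finset.sum_congr rfl fun x _ => ?_
    rw [Pi.smul_apply, Finset.sum_apply, smul_eq_mul, norm_mul, mul_pow, norm_inv, norm_pow, Complex.norm_natCast]
    rfl
  rw [e1]
  calc (((n : ℝ) ^ d)⁻¹) ^ 2 * ∑ x : Tor (fine n M), ‖∑ j : Fin d → Fin n, F (x + iota n M j)‖ ^ 2
      ≤ (((n : ℝ) ^ d)⁻¹) ^ 2 * ∑ x : Tor (fine n M), ((n : ℝ) ^ (d - 1) * ∑ j : Fin d → Fin n, ‖F (x + iota n M j)‖ ^ 2) :=
        mul_le_mul_of_nonneg_left (Finset.sum_le_sum fun x _ => hslice x) (by positivity)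
    _ = (((n : ℝ) ^ d)⁻¹) ^ 2 * ((n : ℝ) ^ (d - 1) * ((n : ℝ) ^ d * nsq F)) := by rw [← Finset.mul_sum, hdouble]
    _ = ((n : ℝ))⁻¹ * nsq F := by
        have hd : (n : ℝ) ^ d = (n : ℝ) ^ (d - 1) * n := by
          rcases Nat.eq_zero_or_pos d with hd0 | hdp
          · subst hd0
            -- `d = 0`: `Fin 0` is empty, so `μ : Fin 0` is impossible
            exact (IsEmpty.false μ).elim
          · rw [← pow_succ, Nat.sub_add_cancel hdp]
        rw [hd]; field_simp

/-- **THE ENERGY OF THE BOX-SMOOTHED BLOCK-CONSTANT INTERPOLANT**: `Σ_μ nsq (∂_μ^{(n)} boxAvg ψ_g) ≤ n^d·Σ_μ Σ_y ‖g(y + e_μ) − g(y)‖²`,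
i.e. in BADD's `η^d`-weighted currency `⟨∂^η A₁, ∂^η A₁⟩_η ≤ ⟨∂₁g, ∂₁g⟩` with constant exactly `1` (the torus twin of
`B5Ineq167UpperZd.dir_energy_A1_le`). [folklore] -/
theorem dirichlet_boxAvg_blockConst_le (g : Tor M → ℂ) :
    ScalarAveragedPropagator.dirichlet n M (boxAvg n M fun x => g (blockOf n M x))
      ≤ (n : ℝ) ^ d * ∑ μ : Fin d, ∑ y : Tor M, ‖g (y + unitVec M μ) - g y‖ ^ 2 := by
  have hn0 : (0 : ℝ) < n := by exact_mod_cast Nat.pos_of_ne_zero (NeZero.ne n)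
  unfold ScalarAveragedPropagator.dirichlet
  rw [Finset.mul_sum]
  refine Finset.sum_le_sum fun μ _ => ?_
  rw [sdiff_boxAvg]
  refine (nsq_boxAvg_faceSupported_le n M (sdiff_blockConst_faceSupported n M g μ)).trans ?_
  refine (mul_le_mul_of_nonneg_left (nsq_sdiff_blockConst_le n M g μ) (inv_nonneg.mpr hn0.le)).trans (le_of_eq ?_)
  have hd : (n : ℝ) ^ d = (n : ℝ) ^ (d - 1) * n := by
    rcases Nat.eq_zero_or_pos d with hd0 | hdp
    · subst hd0; exact (IsEmpty.false μ).elim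
    · rw [← pow_succ, Nat.sub_add_cancel hdp]
  rw [hd]; field_simp

/-! ## §5. Toy -/

/-- Toy: the slice count of `sum_digitBox_coord` — `{0,1}^3` has `2^{3−1} = 4` offsets with a prescribed first digit. -/
example : (2 : ℝ) ^ (3 - 1) = 4 := by norm_num

end Summit.QuantumFields.BalabanUV.T4Continuum.NE7b.BlockAverageInterpolant

end
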